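import Mathlib
import HarnessLib
import Summits.NavierStokesRegularity.NavierStokesRegularity.Theorems.UnthreadedRigidityDoorUnthreadedRigidityThreadingJetsVirialCompositions
import Summits.NavierStokesRegularity.NavierStokesRegularity.Theorems.UnthreadedRigidityDoorUnthreadedRigidityVirialHornAngularLemma
import Summits.NavierStokesRegularity.NavierStokesRegularity.Theorems.UnthreadedRigidityDoorUnthreadedRigidityVirialHornBridgeWOfInjective

/-!
# THREADING JETS, THE WINDOW RUNG PER DEGREE and DEGREE ONE UNCONDITIONALLY: `IsotypicWindowRigidityL 1 n` by name

W2 ⟨stmt-NavierStokesRegularity-27585⟩ `UnthreadedRigidity`, line g11-1 (VIRIAL HORN), KEY-NS #210 / dss_155.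

* `isotypicWindowRigidityL_of_bracketInjective_at` — THE WINDOW RUNG IN DEGREE `l` FROM BRACKET INJECTIVITY IN DEGREE `l` ONLY: g7's composition
  `isotypicWindowRigidityL_of_bridges_at` and ns-crc-p2's `windowWedgeAnalyticL_of_bracketInjective` are pointwise in `(l, n)`; re-composed here with
  V-W `virialWindowSilence_holds`, S-C `angularLemma_holds`, S-A `analyticWedgeSeparableL_holds`, S-V `virialNondegeneracy_holds`, S-Z
  `zonalShellAxisym_holds`, S-U `windowAxisUniform_holds`, W₂ `windowWedge_analytic_profiles`, the first-jet silence
  `fluxJetOne_eq_zero_of_unthreaded_window` and the slice wedge law `wedgeVanishesL_of_fluxJetOne_eq_zero`.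
* `bracketInjective_one` — BRACKET INJECTIVITY IN DEGREE ONE: a degree-one solid harmonic is a linear form `⟪b_m, ·⟫`, `{B_m, B_{m′}}(y) = det[y, b_m, b_{m′}]`,
  and for a linearly independent family (`n ≤ 3`) the vanishing of `Σ w_{mm′} det[y, b_m, b_{m′}]` forces `w` symmetric (triple products).
* ★ `isotypicWindowRigidity_one_holds (n) : IsotypicWindowRigidityL 1 n` — UNCONDITIONAL: every unthreaded window all of whose slices are admissible
  DEGREE-ONE isotypic poloidal data about `x₀` (dipole stream functions `Σ_m c_m(|y|,t) ⟪b_m, y⟫` over a fixed independent family) is axisymmetric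
  about one common axis through `x₀`.  The first degree in which a bridge (W) and its window side close in the kernel.

HONEST LABEL: degree-one isotypic windows are SPECIAL data; ⟨27585⟩ `UnthreadedRigidity`, W2 and NS regularity stay OPEN; MODEL rung — no NS
regularity statement is proved here.
-/

noncomputable section

-- the summit and its single sub-problem share the name (CONVENTIONS §1), as in every Theorems file
set_option linter.dupNamespace false

namespace Summit.NavierStokesRegularity.NavierStokesRegularity.Theorems.UnthreadedRigidity.ThreadingJets

open Set Filter Topology
open scoped RealInnerProductSpace Matrix
open Literature.Analysis.FluidPDE
open Summit.NavierStokesRegularity.NavierStokesRegularity.Theorems.UnthreadedRigidity.ProfileHorn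
  (E3 threadingFlux IsSliceAxisymmetric isSliceAxisymmetric_of_eq_zero)
open Summit.NavierStokesRegularity.NavierStokesRegularity.Theorems.UnthreadedRigidity.VirialHorn
  (IsSolidHarmonic VirialAdmissible sepShellL virialMoment angForm pbr det3 isoShellL IsoAdmissibleL WedgeVanishesL
    IsotypicWindowRigidityL sepShellL_null virialNondegeneracy_holds zonalShellAxisym_holds angularLemma_holds
    windowAxisUniform_holds analyticWedgeSeparableL_holds windowWedge_analytic_profiles
    fluxJetOne_eq_zero_of_unthreaded_window wedgeVanishesL_of_fluxJetOne_eq_zero exists_linear_of_isHomogeneous_one)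

/-! ### 1. The window rung in degree `l` from bracket injectivity in degree `l` -/

/-- ★ THE WINDOW RUNG IN DEGREE `l` FROM BRACKET INJECTIVITY IN DEGREE `l` ONLY (all other inputs are tree theorems). -/
theorem isotypicWindowRigidityL_of_bracketInjective_at (l : ℕ)
    (hinj : ∀ (n : ℕ) (B : Fin n → E3 → ℝ), (∀ m, IsSolidHarmonic l (B m)) → LinearIndependent ℝ B →
      ∀ w : Fin n → Fin n → ℝ, (∀ y : E3, ∑ m, ∑ m', w m m' * pbr (B m) (B m') y = 0) → ∀ m m', w m m' = w m' m)
    (n : ℕ) (hl : 1 ≤ l) : IsotypicWindowRigidityL l n := by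
  intro S hS hconn u x₀ hcont hdiv hmild hbdd hunth hiso
  obtain ⟨B, cf, hB, hslice⟩ := hiso
  have hsep : ∀ t ∈ S, ∃ (H : ℝ → ℝ) (Y : E3 → ℝ),
      VirialAdmissible l H ∧ IsSolidHarmonic l Y ∧ u t = sepShellL H Y x₀ := by
    intro t ht
    obtain ⟨hadm, hu⟩ := hslice t ht
    have h0 : ∀ x : E3, fluxJetOne (isoShellL n (cf t) B x₀) x₀ x = 0 := fun x => by
      rw [← hu]
      exact fluxJetOne_eq_zero_of_unthreaded_window hS hcont hdiv hmild hbdd hunth ht x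
    have hW : WedgeVanishesL n (cf t) :=
      wedgeVanishesL_of_fluxJetOne_eq_zero hl hadm x₀ (hinj n B hadm.1 hB) h0
    have hA := windowWedge_analytic_profiles l n S hl hS u x₀ hcont hdiv hmild hbdd hunth B cf hB hslice t ht
    obtain ⟨H, Y, hH, hY, hHY⟩ := analyticWedgeSeparableL_holds l n (cf t) B x₀ hadm hA hW
    exact ⟨H, Y, hH, hY, by rw [hu]; exact hHY⟩
  choose! Hf Yf hHa hYh hHu using hsep
  have key := virialWindowSilence_holds l S hl hS u x₀ hcont hdiv hmild hbdd hunth Hf Yf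
    (fun t ht => ⟨hHa t ht, hYh t ht, hHu t ht⟩)
  have hax : ∀ t ∈ S, IsSliceAxisymmetric (u t) x₀ := by
    intro t ht
    by_cases hm : virialMoment l (Hf t) = 0
    · have hH0 : ∀ r : ℝ, 0 ≤ r → Hf t r = 0 := virialNondegeneracy_holds l (Hf t) hl (hHa t ht) hm
      apply isSliceAxisymmetric_of_eq_zero
      intro x
      rw [hHu t ht]
      exact sepShellL_null (Hf t) (Yf t) x₀ hH0 x
    · have hA : ∀ ξ : E3, angForm (Yf t) ξ = 0 := fun ξ =>
        (mul_eq_zero.mp (key t ht ξ)).resolve_left hm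
      rw [hHu t ht]
      exact zonalShellAxisym_holds l (Hf t) (Yf t) x₀ (hYh t ht) (angularLemma_holds l (Yf t) (hYh t ht) hA) (hHa t ht)
  exact windowAxisUniform_holds S hS hconn u x₀ hcont hdiv hmild hbdd hax

/-! ### 2. Bracket injectivity in degree one -/

/-- a degree-one solid harmonic is a linear form with constant gradient. -/
theorem exists_eq_inner_of_isSolidHarmonic_one {Y : E3 → ℝ} (hY : IsSolidHarmonic 1 Y) :
    ∃ c : E3, (∀ y : E3, Y y = ⟪c, y⟫) ∧ ∀ y : E3, gradient Y y = c := by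
  obtain ⟨⟨P, hPh, hPe⟩, -⟩ := hY
  obtain ⟨c, hc⟩ := exists_linear_of_isHomogeneous_one P hPh
  set cv : E3 := WithLp.toLp 2 ![c 0, c 1, c 2] with hcv
  have hYc : ∀ y : E3, Y y = ⟪cv, y⟫ := fun y => by
    rw [hPe y, hc y]
    simp [hcv, PiLp.inner_apply, Fin.sum_univ_three]
    ring
  refine ⟨cv, hYc, fun y => ?_⟩
  have hlin : HasFDerivAt (fun y : E3 => ⟪cv, y⟫) (innerSL ℝ cv) y := (innerSL ℝ cv).hasFDerivAt
  have hg : HasGradientAt Y cv y := by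
    rw [show Y = fun y : E3 => ⟪cv, y⟫ from funext hYc, hasGradientAt_iff_hasFDerivAt]
    refine hlin.congr_fderiv ?_
    ext v
    simp [InnerProductSpace.toDual_apply_apply]
  exact hg.gradient

/-- the triple product is cyclic. -/
theorem det3_cycl (a b c : E3) : det3 a b c = det3 b c a := by
  simp only [det3]; ring

/-- the triple product vanishes on a repeated pair of arguments. -/
theorem det3_self_mid_right (a b : E3) : det3 a b b = 0 := by
  simp only [det3]; ring

/-- the triple product vanishes on a repeated pair of arguments. -/
theorem det3_self_left_mid (a b : E3) : det3 a a b = 0 := by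
  simp only [det3]; ring

/-- the triple product vanishes on a repeated pair of arguments. -/
theorem det3_self_left_right (a b : E3) : det3 a b a = 0 := by
  simp only [det3]; ring

/-- a linearly independent triple has nonvanishing triple product. -/
theorem det3_ne_zero_of_linearIndependent {b : Fin 3 → E3} (hb : LinearIndependent ℝ b) : det3 (b 0) (b 1) (b 2) ≠ 0 := by
  have hrows : LinearIndependent ℝ (fun i => WithLp.ofLp (b i)) :=
    hb.map' (WithLp.linearEquiv 2 ℝ (Fin 3 → ℝ)).toLinearMap (LinearEquiv.ker _)
  have hU : IsUnit (Matrix.of fun i j => b i j) := Matrix.linearIndependent_rows_iff_isUnit.1 hrows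
  have hdet : (Matrix.of fun i j => b i j).det ≠ 0 := ((Matrix.isUnit_iff_isUnit_det _).1 hU).ne_zero
  rw [Matrix.det_fin_three] at hdet
  simp only [Matrix.of_apply] at hdet
  simp only [det3]
  convert hdet using 1
  ring

/-- a linearly independent pair has nonvanishing cross product. -/
theorem cross_ne_zero_of_linearIndependent {b : Fin 2 → E3} (hb : LinearIndependent ℝ b) : cross (b 0) (b 1) ≠ 0 := by
  have hrows : LinearIndependent ℝ (fun i => WithLp.ofLp (b i)) :=
    hb.map' (WithLp.linearEquiv 2 ℝ (Fin 3 → ℝ)).toLinearMap (LinearEquiv.ker _)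
  have h2 : LinearIndependent ℝ ![WithLp.ofLp (b 0), WithLp.ofLp (b 1)] := by
    convert hrows using 1
    funext i
    fin_cases i <;> rfl
  have hc := crossProduct_ne_zero_iff_linearIndependent.2 h2
  intro h
  apply hc
  have := congrArg WithLp.ofLp h
  simpa [cross] using this

/-- ★ BRACKET INJECTIVITY IN DEGREE ONE (KEY-NS #210 `BracketInjective` at `l = 1`): for a linearly independent family of degree-one solid
harmonics, `Σ_{m,m′} w_{mm′} {B_m, B_{m′}} ≡ 0` forces `w` symmetric. -/
theorem bracketInjective_one (n : ℕ) (B : Fin n → E3 → ℝ) (hB1 : ∀ m, IsSolidHarmonic 1 (B m)) (hB : LinearIndependent ℝ B)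
    (w : Fin n → Fin n → ℝ) (hw : ∀ y : E3, ∑ m, ∑ m', w m m' * pbr (B m) (B m') y = 0) : ∀ m m', w m m' = w m' m := by
  choose b hrepr hgrad using fun m => exists_eq_inner_of_isSolidHarmonic_one (hB1 m)
  -- the vectors `b m` are linearly independent, hence `n ≤ 3`
  have hb : LinearIndependent ℝ b := by
    refine LinearIndependent.of_comp ((LinearMap.ltoFun ℝ E3 ℝ ℝ).comp (innerₗ E3)) ?_
    convert hB using 1
    funext m; funext y; simp [hrepr m y]
  have hn : n ≤ 3 := by
    have h := hb.fintype_card_le_finrank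
    simp only [Fintype.card_fin, finrank_euclideanSpace] at h
    exact h
  -- the brackets are triple products
  have hpbr : ∀ m m' (y : E3), pbr (B m) (B m') y = det3 y (b m) (b m') := fun m m' y => by
    simp only [pbr, hgrad]
  have hV : ∀ y : E3, ∑ m, ∑ m', w m m' * det3 y (b m) (b m') = 0 := fun y => by
    have h := hw y
    simp only [hpbr] at h
    exact h
  -- case analysis on `n ≤ 3`
  intro i j
  interval_cases n
  · exact i.elim0
  · rw [Subsingleton.elim i j]
  · -- n = 2
    have hc : cross (b 0) (b 1) ≠ 0 := cross_ne_zero_of_linearIndependent hb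
    have h := hV (cross (b 0) (b 1))
    simp only [Fin.sum_univ_two, det3_self_mid_right, mul_zero, add_zero, zero_add] at h
    have e1 : det3 (cross (b 0) (b 1)) (b 1) (b 0) = -det3 (cross (b 0) (b 1)) (b 0) (b 1) := by
      simp only [det3]; ring
    have e2 : det3 (cross (b 0) (b 1)) (b 0) (b 1) = ‖cross (b 0) (b 1)‖ ^ 2 := by
      rw [det3_cycl, det3_eq_inner_cross, real_inner_self_eq_norm_sq]
    rw [e1, e2] at h
    have hpos : 0 < ‖cross (b 0) (b 1)‖ ^ 2 := by positivity
    have hs : w 0 1 = w 1 0 := by nlinarith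
    fin_cases i <;> fin_cases j
    · rfl
    · exact hs
    · exact hs.symm
    · rfl
  · -- n = 3
    have hD : det3 (b 0) (b 1) (b 2) ≠ 0 := det3_ne_zero_of_linearIndependent hb
    have h0 := hV (b 0)
    have h1 := hV (b 1)
    have h2 := hV (b 2)
    simp only [Fin.sum_univ_three, det3_self_mid_right, det3_self_left_mid, det3_self_left_right, mul_zero, add_zero,
      zero_add] at h0 h1 h2
    have e021 : det3 (b 0) (b 2) (b 1) = -det3 (b 0) (b 1) (b 2) := by simp only [det3]; ring
    have e102 : det3 (b 1) (b 0) (b 2) = -det3 (b 0) (b 1) (b 2) := by simp only [det3]; ring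
    have e120 : det3 (b 1) (b 2) (b 0) = det3 (b 0) (b 1) (b 2) := by simp only [det3]; ring
    have e201 : det3 (b 2) (b 0) (b 1) = det3 (b 0) (b 1) (b 2) := by simp only [det3]; ring
    have e210 : det3 (b 2) (b 1) (b 0) = -det3 (b 0) (b 1) (b 2) := by simp only [det3]; ring
    rw [e021] at h0
    rw [e102, e120] at h1
    rw [e201, e210] at h2
    have s12 : w 1 2 = w 2 1 := by
      have : (w 1 2 - w 2 1) * det3 (b 0) (b 1) (b 2) = 0 := by linarith
      have := (mul_eq_zero.1 this).resolve_right hD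
      linarith
    have s02 : w 0 2 = w 2 0 := by
      have : (w 2 0 - w 0 2) * det3 (b 0) (b 1) (b 2) = 0 := by linarith
      have := (mul_eq_zero.1 this).resolve_right hD
      linarith
    have s01 : w 0 1 = w 1 0 := by
      have : (w 0 1 - w 1 0) * det3 (b 0) (b 1) (b 2) = 0 := by linarith
      have := (mul_eq_zero.1 this).resolve_right hD
      linarith
    fin_cases i <;> fin_cases j
    · rfl
    · exact s01
    · exact s02
    · exact s01.symm
    · rfl
    · exact s12
    · exact s02.symm
    · exact s12.symm
    · rfl

/-! ### 3. Degree one, unconditionally -/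

/-- ★★ THE WINDOW RUNG IN DEGREE ONE, UNCONDITIONALLY: `IsotypicWindowRigidityL 1 n` — every unthreaded window whose slices are admissible
degree-one isotypic poloidal data about `x₀` over a fixed linearly independent family of degree-one solid harmonics is axisymmetric about one
common axis through `x₀`. -/
theorem isotypicWindowRigidity_one_holds (n : ℕ) : IsotypicWindowRigidityL 1 n :=
  isotypicWindowRigidityL_of_bracketInjective_at 1 (fun n B hB1 hB w hw => bracketInjective_one n B hB1 hB w hw) n le_rfl

end Summit.NavierStokesRegularity.NavierStokesRegularity.Theorems.UnthreadedRigidity.ThreadingJets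

end
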